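import Literature.MathematicalPhysics.QuantumFieldTheory.BalabanImbrieJaffe1984to88.BIJ88Eq5145HeadMultiCube
import Literature.MathematicalPhysics.QuantumFieldTheory.BalabanImbrieJaffe1984to88.BIJ88Ineq5144LocatedWitness
import Literature.MathematicalPhysics.QuantumFieldTheory.BalabanImbrieJaffe1984to88.BIJ88Eq5145LocatedInstance

/-!
# `BalabanImbrieJaffe1984to88.BIJ88Eq5145HeadMultiCubeInstance` — T. Bałaban, J. Imbrie, A. Jaffe, *Effective action and cluster properties
of the abelian Higgs model*, Commun. Math. Phys. **114** (1988) 257–315 [BalabanImbrieJaffe1988], Sect. 5.14, (5.14.5) p. 312 [PDF 56] with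
(5.14.4) p. 309 [PDF 53]: **A KERNEL CERTIFICATE THAT THE HYPOTHESIS FAMILY OF THE SUCCESSOR-HEAD CANDIDATE
`BIJ88Eq5145HeadMultiCube.eq5145_zG_mod_W6v_of_ineq5144_two_le` (p36 gen 15) IS JOINTLY SATISFIABLE** — the candidate INSTANTIATED on the
§5.13 data of p36 gen 14's `BIJ88Eq5145LocatedInstance` / `BIJ88Ineq5144LocatedWitness` with the interaction switched off, every hypothesis
discharged; two closed forms with no hypothesis left, the second on a TWO-CUBE model so that the binder «`2 ≤ |X″|`» of the multi-cube leaf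
hypothesis `h5144two` is inhabited.

statement-level skeleton of published theorems with citation tags; proofs where landed; nothing here is a claim about the Yang–Mills mass gap

p. 309, verbatim: *"Let us drop the prime, and prove that |g₃(H_β, X_β)| ≤ (e^β(L^kε/ε₀)^{1/4−α})^{[|H_β| + β′|X_β∖H_β|]}. (5.14.4) … The proof
of this estimate is similar to the one for g₂. … The bound for H_β = ∅, |X_β| = 1 was obtained for g₂, and the same proof applies here."*
p. 312: the identity (5.14.5).  PDF held: `paper:balaban1988-cmp114-bij-abelian-higgs-effective-action` (journal page = PDF page + 256);
pp. 309, 312 = PDF 53, 56 (text layer `p0053.txt`, `p0056.txt`) re-read by this seat 2026-08-22.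

WHY (row bookkeeping, not mathematics of the paper).  Row **C2.Eq5.14.5** of `HOME/lit-balaban-r16/ROWS-C2-part2.md` (owner r16 = this seat;
referee ref-5) is «proved with clauses», head theorem of record `BIJ88Eq5145CornerW6Loc.eq5145_zG_mod_W6v_of_ineq5144_loc` (p330573) with its
kernel non-vacuity certificate `BIJ88Eq5145LocatedInstance` (p331132) — the row's standard since GAPS G-C2-p36-07 (a head of record carries a
kernel instance of ITS OWN hypothesis family).  p36 gen 15 offered the refinement `…_two_le` (p337083): the leaf (5.14.4) assumed on the
MULTI-CUBE polymers `|X_β| ≥ 2` only, its one-cube part being the theorem `BIJ88Ineq5144OneCube.ineq5144_locAct_singleton_of_const`, at the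
price of the one-cube regime as explicit hypotheses (an all-orders derivative constant `Ĉ`, one-cube tails `A, κ`, `K₁`, `G`, `e_k ≤ θ`,
`n̄ + 2 ≤ κ(81/100)c₀²|log e_k⁻¹|^{2p−1}`, `Ĉ^{n̄+1}Ae^{GK₁}e_k ≤ 1`, `K_Y e^{GK₁} ≤ θ`, `e^{GK₁}GAe_k + (e^{GK₁} − 1) ≤ θ^{β′}`).  The owner's
pointer-switch criterion (ROWS-C2-part2 v2.191) is a kernel instance of the candidate; this file is that instance.

WHAT IS PROVED (0 `sorry`, 0 definitions, 0 `Prop` facts; standard axioms).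
* **`eq5145_two_le_instance`** — `eq5145_zG_mod_W6v_of_ineq5144_two_le` APPLIED to the data of `BIJ88Eq5145LocatedInstance.eq5145_loc_instance`
  with the interaction switched off (`V ≡ 0`): block-diagonal `Δ ≻ 0` (no inter-cube coupling), any source `ℱ`, no χ-slots `B = ∅`, one
  interaction slot per cube, `𝒫^L = 0`, `W₆″_ρ(X′) = [X′ = ∅]·𝒫̃_ρ`.  Discharged inside: `h5144two` by p36 gen 14's `ineq5144_locAct_witness`
  (the located leaf for these data, restricted to `2 ≤ |X″|`); the all-orders constant by `BIJ88GaussIntegration309Product.exists_const_all_orders`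
  (orders `≤ n̄+1`); the tail hypothesis vacuously (`B = ∅`) with `A = 0`; `K_Y = K₁ = 0`; `G =` the number of slots; `c₀ = 1`;
  `κ := (n̄+2)/((81/100)(log e_k⁻¹)^{2p−1})`, which meets the `|log e_k⁻¹|` condition with equality; the three interaction-smallness
  inequalities hold with zeros.  Displayed: the hypotheses of `eq5145_loc_instance` (gen 5's numerical regime `16(D+1)²e²θ^{β′/2} ≤ 1`,
  `χ ≥ 0`, `p > 1/2`, `0 < e_k < e^{−1}`, a symmetric abutting relation of degree `≤ D`, a cube-local `F`, `|L′| = n̄+1`) and ONE more: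
  **`e_k ≤ θ`**.
* **`eq5145_two_le_instance_closed`** — the numbers fixed (`adj = ⊥`, `D = 0`, `θ = e^{−12}`, `β′ = 1`, `χ =` p36 gen 7's `gevreyCutoff`,
  `p = 1`, `e_k = e^{−12}`, `F ≡ 1`, `L′ = Unit`): only the model instance (`blk`, a block-diagonal `Δ ≻ 0`, `ℱ`, the cube map, `W`, `B_large`,
  `γ`) is displayed (`toy_regime` of p331132 re-used).
* **`eq5145_two_le_instance_two_cubes`** — the model fixed as well, with TWO cubes: sites = cubes = `Fin 2`, `blk = id`, `Δ = 1`, `ℱ = 0`,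
  `W = univ`, `B_large = ∅`, one outer label located in cube `0`.  A CLOSED theorem, no hypotheses; the binder `2 ≤ |X″|` of `h5144two` is
  met by `X″ = univ`, so the multi-cube hypothesis is exercised with a true premise (on these data its located activity vanishes, as
  `ineq5144_locAct_witness` shows — a degenerate but legal datum).

HONEST SCOPE.  A satisfiability certificate for the quantifier structure of the successor-head candidate, nothing more — exactly as p331132 is
for the head of record: unit-free §5.13 toy data, interaction off, no χ-slots; NOT a step of the paper's argument; (5.14.4) for the paper's
data (the inductive cluster-expansion decay on `|X_β| ≥ 2`) is NOT proved here or anywhere in the tree.  Imports `BIJ88Eq5145HeadMultiCube`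
(p36 g15, p337083), `BIJ88Ineq5144LocatedWitness` (p36 g14, p329974), `BIJ88Eq5145LocatedInstance` (p36 g14, p331132: `toy_regime`, and
through it p36 g7's `BIJ88CutoffProfileWitness`).  The χ-slot index type carries `[Fintype ι]` (the candidate's signature); p331132 needs none.  NOT summit progress; NOT continuum;
NOT Clay.  Cell `lit-balaban` Phase 2; unit `lit-balaban-r16` gen 17 (row owner's own certificate for its recorded pointer-switch criterion;
referee ref-5 countersign invited on the switch).
-/

noncomputable section

open Finset MeasureTheory
open Literature.MathematicalPhysics.QuantumFieldTheory.BalabanImbrieJaffe1984to88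
open BIJ88PolymerRep5134 (g1 IsAdmissible corner)
open BIJ88PolymerRep5134Gauss (expect zG)
open BIJ88Resummation5141 (outer lam12)
open BIJ88Resummation5141Adm (lam12')
open BIJ88Expansion5143Gauss (fD)
open BIJ88SlotMomentsGauss308 (uD)
open BIJ88Sect5Statements (CutoffProfile)
open BIJ88Sect5StatementsPart4 (pertP)
open BIJ88Eq5145CornerModel (ztIn)
open BIJ88W6PrimeVsupp (W6v)
open BIJ88CutoffProfileWitness (gevreyCutoff chi1_nonneg)
open BIJ88GaussIntegration309Product (exists_const_all_orders)
open BIJ88Eq5145HeadMultiCube (eq5145_zG_mod_W6v_of_ineq5144_two_le)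
open BIJ88Ineq5144LocatedWitness (ineq5144_locAct_witness)
open BIJ88Eq5145LocatedInstance (toy_regime)

namespace Literature.MathematicalPhysics.QuantumFieldTheory.BalabanImbrieJaffe1984to88.BIJ88Eq5145HeadMultiCubeInstance

variable {α I : Type} [Fintype α] [DecidableEq α] [Fintype I] [DecidableEq I]
  (blk : α → I) {Δ : Matrix α α ℝ} (ℱ : α → ℝ) (adj : I → I → Prop) [DecidableRel adj]
  (χ : CutoffProfile) {ι : Type*} [Fintype ι] [DecidableEq ι] (p ek : ℝ) (Φ : ι → (α → ℝ) → ℝ) (c : ι → ℝ)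
  {cube : ↥(∅ : Finset ι) ⊕ ↥(univ : Finset I) → I}

/-- **THE SUCCESSOR-HEAD CANDIDATE OF ROW C2.Eq5.14.5 INSTANTIATED ON §5.13 DATA** (block-diagonal `Δ ≻ 0`, no χ-slots, one interaction slot
per cube with the interaction switched off `V ≡ 0`): its multi-cube leaf hypothesis `h5144two` is discharged by
`BIJ88Ineq5144LocatedWitness.ineq5144_locAct_witness`, its one-cube regime by explicit constants (`Ĉ` from `exists_const_all_orders`, `A = 0`,
`K₁ = 0`, `c₀ = 1`, `κ = (n̄+2)/((81/100)(log e_k⁻¹)^{2p−1})`), `h311` by `𝒫^L = 0`, `W₆″_ρ(X′) = [X′ = ∅]·𝒫̃_ρ`; left displayed: gen 5's regime,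
`χ ≥ 0`, `p > 1/2`, `0 < e_k < e^{−1}`, `e_k ≤ θ`, a symmetric abutting relation of degree `≤ D`, a cube-local `F`, `|L′| = n̄+1` — and the
conclusion is the (5.14.5) identity of the head for these data. [cite: BalabanImbrieJaffe1988, (5.14.5) p.312; (5.14.4) p.309; p.310 display 4; p.311] -/
theorem eq5145_two_le_instance (hΔ0 : ∀ x y, blk x ≠ blk y → Δ x y = 0) (hΔ : Δ.PosDef) (hcube : ∀ Y, cube (Sum.inr Y) = Y.1)
    {nbr : I → Finset I} {D : ℕ} {θ β' : ℝ} (hR : ∀ x y, adj x y → adj y x) (hD : ∀ x, (nbr x).card ≤ D)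
    (hnbr : ∀ x y, adj x y → y ∈ nbr x) (hθ0 : 0 < θ) (hθ1 : θ ≤ 1) (hβ0 : 0 ≤ β') (hβ1 : β' ≤ 1)
    (hsmall : 16 * ((D : ℝ) + 1) ^ 2 * (θ ^ (β' / 2) * Real.exp 2) ≤ 1) (hχ : ∀ x, 0 ≤ χ.χ₁ x) (hp : 1 / 2 < p)
    (hek : 0 < ek) (hek1 : ek < Real.exp (-1)) (hekθ : ek ≤ θ)
    (F : I → (α → ℝ) → ℝ) (hFloc : ∀ i (φ ψ : α → ℝ), (∀ x, blk x = i → φ x = ψ x) → F i φ = F i ψ)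
    {L' : Type} [Fintype L'] [DecidableEq L'] {nbar : ℕ} (hL : Fintype.card L' = nbar + 1) (W Bl : Finset I)
    {L : Type*} (γ : L → ↥(∅ : Finset ι) ⊕ ↥(univ : Finset I)) :
    Real.exp (-0) * expect blk Δ ℱ
        (fun i φ => fD (uD χ p ek (∅ : Finset ι) Φ c (univ : Finset I) (fun _ _ => (0 : ℝ)) 1) cube γ ∅ i φ * F i φ) W (corner ℝ W) =
      ∑ ρ ∈ (outer W Bl).filter (IsAdmissible adj),
        (∏ X ∈ ρ, g1 adj (zG blk Δ ℱ (fun i φ => fD (uD χ p ek (∅ : Finset ι) Φ c (univ : Finset I) (fun _ _ => (0 : ℝ)) 1) cube γ ∅ i φ *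
            F i φ)) X) *
          (zG blk Δ ℱ (fun i φ => fD (uD χ p ek (∅ : Finset ι) Φ c (univ : Finset I) (fun _ _ => (0 : ℝ)) 1) cube γ ∅ i φ * F i φ)
                (lam12 W ρ) (lam12' adj W ρ) /
              zG blk Δ ℱ (fD (uD χ p ek (∅ : Finset ι) Φ c (univ : Finset I) (fun _ _ => (0 : ℝ)) 1) cube γ ∅) (lam12 W ρ) (lam12' adj W ρ) *
            Real.exp (-0 - ∑ X' : Finset I,
              (W6v blk Δ ℱ adj χ p ek (∅ : Finset ι) Φ c (univ : Finset I) (fun _ _ => (0 : ℝ)) cube (lam12' adj W ρ) (lam12 W ρ) L' nbar X' +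
                (if X' = ∅ then pertP (fun t => Real.log (ztIn blk Δ ℱ χ p ek (∅ : Finset ι) Φ c (univ : Finset I) (fun _ _ => (0 : ℝ)) cube
                  (lam12 W ρ) (lam12' adj W ρ) t)) nbar else 0)))) := by
  obtain ⟨C, hC1, hC⟩ := exists_const_all_orders χ p (nbar + 1)
  -- the `|log e_k⁻¹|` condition met with equality by the choice of `κ` (the tail hypothesis being vacuous, `κ` is free)
  have hlog : 0 < Real.log ek⁻¹ := Real.log_pos ((one_lt_inv₀ hek).2 (hek1.trans (Real.exp_lt_one_iff.2 (by norm_num))))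
  have hLpos : 0 < Real.log ek⁻¹ ^ (2 * p - 1) := Real.rpow_pos_of_pos hlog _
  have hden : 0 < (81 / 100 : ℝ) * (1 : ℝ) ^ 2 * Real.log ek⁻¹ ^ (2 * p - 1) := by positivity
  set κ : ℝ := (((nbar + 1 : ℕ) : ℝ) + 1) / ((81 / 100 : ℝ) * (1 : ℝ) ^ 2 * Real.log ek⁻¹ ^ (2 * p - 1)) with hκdef
  have hκ0 : 0 ≤ κ := div_nonneg (by positivity) hden.le
  have hreg : ((nbar + 1 : ℕ) : ℝ) + 1 ≤ κ * (81 / 100) * (1 : ℝ) ^ 2 * Real.log ek⁻¹ ^ (2 * p - 1) := by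
    have : κ * (81 / 100) * (1 : ℝ) ^ 2 * Real.log ek⁻¹ ^ (2 * p - 1) =
        κ * ((81 / 100 : ℝ) * (1 : ℝ) ^ 2 * Real.log ek⁻¹ ^ (2 * p - 1)) := by ring
    rw [this, hκdef, div_mul_cancel₀ _ hden.ne']
  exact eq5145_zG_mod_W6v_of_ineq5144_two_le blk Δ ℱ adj χ cube γ hR hD hnbr hθ0 hθ1 hβ0 hsmall (fun x y hxy _ => hΔ0 x y hxy) hΔ hχ hp
    (fun b hb => absurd hb (notMem_empty b)) one_pos (fun b hb => absurd hb (notMem_empty b)) (fun _ _ => measurable_const)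
    (KY := fun _ => (0 : ℝ)) (fun _ _ _ => by simp) hek hek1 (fun b => absurd b.2 (notMem_empty _)) (fun _ _ _ _ => rfl) F hFloc hL W Bl 0 0
    (fun ρ X' => if X' = ∅ then pertP (fun t => Real.log (ztIn blk Δ ℱ χ p ek (∅ : Finset ι) Φ c (univ : Finset I) (fun _ _ => (0 : ℝ)) cube
      (lam12 W ρ) (lam12' adj W ρ) t)) nbar else 0)
    hC1 hC (K₁ := 0) le_rfl (fun _ _ => le_rfl) (G := Fintype.card (↥(∅ : Finset ι) ⊕ ↥(univ : Finset I)))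
    (fun _ => (card_filter_le _ _).trans (card_univ (α := ↥(∅ : Finset ι) ⊕ ↥(univ : Finset I))).le) (A := 0) (κ := κ) le_rfl hκ0
    (fun _ b => absurd b.2 (notMem_empty _)) hekθ hreg (by simp) (fun _ _ => by rw [zero_mul]; exact hθ0.le)
    (by simpa using Real.rpow_nonneg hθ0.le β')
    (fun ρ _ X' _ t ht γ' H X'' _ =>
      ineq5144_locAct_witness blk ℱ adj χ p ek Φ c 0 hΔ0 hΔ hcube hθ0 hθ1 hβ1 le_rfl hθ0.le (lam12' adj W ρ) X' ⟨ht.1.le, ht.2⟩ γ' H X'')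
    (fun ρ _ => by simp)

omit [DecidableRel adj] in
/-- **THE CANDIDATE WITH EVERY NUMBER FIXED — ITS HYPOTHESIS FAMILY IS JOINTLY SATISFIABLE** (`adj = ⊥`, `D = 0`, `θ = e^{−12}`, `β′ = 1`,
`χ = gevreyCutoff`, `p = 1`, `e_k = e^{−12}` (so `e_k ≤ θ`), `F ≡ 1`, `L′ = Unit`): only the model instance (`blk`, block-diagonal `Δ ≻ 0`, `ℱ`,
the cube map, `W`, `B_large`, `γ`) is displayed. [cite: BalabanImbrieJaffe1988, (5.14.5) p.312; (5.14.4) p.309] -/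
theorem eq5145_two_le_instance_closed (hΔ0 : ∀ x y, blk x ≠ blk y → Δ x y = 0) (hΔ : Δ.PosDef) (hcube : ∀ Y, cube (Sum.inr Y) = Y.1)
    (W Bl : Finset I) {L : Type*} (γ : L → ↥(∅ : Finset ι) ⊕ ↥(univ : Finset I)) :
    Real.exp (-0) * expect blk Δ ℱ
        (fun i φ => fD (uD gevreyCutoff 1 (Real.exp (-12)) (∅ : Finset ι) Φ c (univ : Finset I) (fun _ _ => (0 : ℝ)) 1) cube γ ∅ i φ *
          (fun (_ : I) (_ : α → ℝ) => (1 : ℝ)) i φ) W (corner ℝ W) =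
      ∑ ρ ∈ (outer W Bl).filter (IsAdmissible fun _ _ : I => False),
        (∏ X ∈ ρ, g1 (fun _ _ : I => False) (zG blk Δ ℱ (fun i φ => fD (uD gevreyCutoff 1 (Real.exp (-12)) (∅ : Finset ι) Φ c
          (univ : Finset I) (fun _ _ => (0 : ℝ)) 1) cube γ ∅ i φ * (fun (_ : I) (_ : α → ℝ) => (1 : ℝ)) i φ)) X) *
          (zG blk Δ ℱ (fun i φ => fD (uD gevreyCutoff 1 (Real.exp (-12)) (∅ : Finset ι) Φ c (univ : Finset I) (fun _ _ => (0 : ℝ)) 1)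
                cube γ ∅ i φ * (fun (_ : I) (_ : α → ℝ) => (1 : ℝ)) i φ) (lam12 W ρ) (lam12' (fun _ _ : I => False) W ρ) /
              zG blk Δ ℱ (fD (uD gevreyCutoff 1 (Real.exp (-12)) (∅ : Finset ι) Φ c (univ : Finset I) (fun _ _ => (0 : ℝ)) 1) cube γ ∅)
                (lam12 W ρ) (lam12' (fun _ _ : I => False) W ρ) *
            Real.exp (-0 - ∑ X' : Finset I,
              (W6v blk Δ ℱ (fun _ _ : I => False) gevreyCutoff 1 (Real.exp (-12)) (∅ : Finset ι) Φ c (univ : Finset I)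
                  (fun _ _ => (0 : ℝ)) cube (lam12' (fun _ _ : I => False) W ρ) (lam12 W ρ) Unit 0 X' +
                (if X' = ∅ then pertP (fun t => Real.log (ztIn blk Δ ℱ gevreyCutoff 1 (Real.exp (-12)) (∅ : Finset ι) Φ c (univ : Finset I)
                  (fun _ _ => (0 : ℝ)) cube (lam12 W ρ) (lam12' (fun _ _ : I => False) W ρ) t)) 0 else 0)))) :=
  eq5145_two_le_instance blk ℱ (fun _ _ : I => False) gevreyCutoff 1 (Real.exp (-12)) Φ c hΔ0 hΔ hcube (nbr := fun _ => ∅)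
    (D := 0) (θ := Real.exp (-12)) (β' := 1) (fun _ _ h => h.elim) (fun _ => by simp) (fun _ _ h => h.elim) (Real.exp_pos _)
    (Real.exp_le_one_iff.2 (by norm_num)) zero_le_one le_rfl toy_regime chi1_nonneg (by norm_num) (Real.exp_pos _)
    (Real.exp_lt_exp.2 (by norm_num)) le_rfl (fun _ _ => (1 : ℝ)) (fun _ _ _ _ => rfl) (L' := Unit) (nbar := 0) (by simp) W Bl γ

/-- **… AND ON A TWO-CUBE MODEL WITH EVERYTHING FIXED — A CLOSED THEOREM, NO HYPOTHESES**: two sites = two cubes (`α = I = Fin 2`,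
`blk = id`), `Δ = 1` (block-diagonal), `ℱ = 0`, no χ-slot index (`ι = Unit`, `B = ∅`; the idle χ-branch of the cube map sent to cube `0`), the interaction slots of the cubes, `W = univ`,
`B_large = ∅`, one outer label located in cube `0`.  The binder `2 ≤ |X″|` of the multi-cube leaf hypothesis is inhabited (`X″ = univ`), so the
successor-head candidate has an instance in which every implication-shaped hypothesis has a true premise somewhere.
[cite: BalabanImbrieJaffe1988, (5.14.5) p.312; (5.14.4) p.309] -/
theorem eq5145_two_le_instance_two_cubes :
    Real.exp (-0) * expect (id : Fin 2 → Fin 2) (1 : Matrix (Fin 2) (Fin 2) ℝ) (0 : Fin 2 → ℝ)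
        (fun i φ => fD (uD gevreyCutoff 1 (Real.exp (-12)) (∅ : Finset Unit) (fun _ _ => (0 : ℝ)) (fun _ => (0 : ℝ)) (univ : Finset (Fin 2))
          (fun _ _ => (0 : ℝ)) 1) (fun τ => Sum.elim (fun _ => (0 : Fin 2)) (fun Y => Y.1) τ)
          (fun _ : Unit => Sum.inr ⟨(0 : Fin 2), mem_univ _⟩) ∅ i φ *
          (fun (_ : Fin 2) (_ : Fin 2 → ℝ) => (1 : ℝ)) i φ) univ (corner ℝ univ) =
      ∑ ρ ∈ (outer (univ : Finset (Fin 2)) ∅).filter (IsAdmissible fun _ _ : Fin 2 => False),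
        (∏ X ∈ ρ, g1 (fun _ _ : Fin 2 => False) (zG (id : Fin 2 → Fin 2) (1 : Matrix (Fin 2) (Fin 2) ℝ) (0 : Fin 2 → ℝ)
          (fun i φ => fD (uD gevreyCutoff 1 (Real.exp (-12)) (∅ : Finset Unit) (fun _ _ => (0 : ℝ)) (fun _ => (0 : ℝ))
            (univ : Finset (Fin 2)) (fun _ _ => (0 : ℝ)) 1) (fun τ => Sum.elim (fun _ => (0 : Fin 2)) (fun Y => Y.1) τ)
            (fun _ : Unit => Sum.inr ⟨(0 : Fin 2), mem_univ _⟩) ∅ i φ *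
            (fun (_ : Fin 2) (_ : Fin 2 → ℝ) => (1 : ℝ)) i φ)) X) *
          (zG (id : Fin 2 → Fin 2) (1 : Matrix (Fin 2) (Fin 2) ℝ) (0 : Fin 2 → ℝ)
              (fun i φ => fD (uD gevreyCutoff 1 (Real.exp (-12)) (∅ : Finset Unit) (fun _ _ => (0 : ℝ)) (fun _ => (0 : ℝ))
                (univ : Finset (Fin 2)) (fun _ _ => (0 : ℝ)) 1) (fun τ => Sum.elim (fun _ => (0 : Fin 2)) (fun Y => Y.1) τ)
                (fun _ : Unit => Sum.inr ⟨(0 : Fin 2), mem_univ _⟩) ∅ i φ *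
                (fun (_ : Fin 2) (_ : Fin 2 → ℝ) => (1 : ℝ)) i φ) (lam12 univ ρ) (lam12' (fun _ _ : Fin 2 => False) univ ρ) /
              zG (id : Fin 2 → Fin 2) (1 : Matrix (Fin 2) (Fin 2) ℝ) (0 : Fin 2 → ℝ)
                (fD (uD gevreyCutoff 1 (Real.exp (-12)) (∅ : Finset Unit) (fun _ _ => (0 : ℝ)) (fun _ => (0 : ℝ)) (univ : Finset (Fin 2))
                  (fun _ _ => (0 : ℝ)) 1) (fun τ => Sum.elim (fun _ => (0 : Fin 2)) (fun Y => Y.1) τ)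
                  (fun _ : Unit => Sum.inr ⟨(0 : Fin 2), mem_univ _⟩) ∅)
                (lam12 univ ρ) (lam12' (fun _ _ : Fin 2 => False) univ ρ) *
            Real.exp (-0 - ∑ X' : Finset (Fin 2),
              (W6v (id : Fin 2 → Fin 2) (1 : Matrix (Fin 2) (Fin 2) ℝ) (0 : Fin 2 → ℝ) (fun _ _ : Fin 2 => False) gevreyCutoff 1 (Real.exp (-12))
                  (∅ : Finset Unit) (fun _ _ => (0 : ℝ)) (fun _ => (0 : ℝ)) (univ : Finset (Fin 2)) (fun _ _ => (0 : ℝ))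
                  (fun τ => Sum.elim (fun _ => (0 : Fin 2)) (fun Y => Y.1) τ)
                  (lam12' (fun _ _ : Fin 2 => False) univ ρ) (lam12 univ ρ) Unit 0 X' +
                (if X' = ∅ then pertP (fun t => Real.log (ztIn (id : Fin 2 → Fin 2) (1 : Matrix (Fin 2) (Fin 2) ℝ) (0 : Fin 2 → ℝ) gevreyCutoff 1
                  (Real.exp (-12)) (∅ : Finset Unit) (fun _ _ => (0 : ℝ)) (fun _ => (0 : ℝ)) (univ : Finset (Fin 2)) (fun _ _ => (0 : ℝ))
                  (fun τ => Sum.elim (fun _ => (0 : Fin 2)) (fun Y => Y.1) τ) (lam12 univ ρ)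
                  (lam12' (fun _ _ : Fin 2 => False) univ ρ) t)) 0 else 0)))) :=
  by
  -- elaborated WITHOUT the expected type (`have`), `ι := Unit` given explicitly (the χ-slot index type occurs in the statement only through
  -- `(∅ : Finset ι)`): expected-type-driven elaboration of this application runs the unifier out of heartbeats
  have h := eq5145_two_le_instance_closed (id : Fin 2 → Fin 2) (Δ := 1) (0 : Fin 2 → ℝ) (ι := Unit) (fun _ _ => (0 : ℝ))
    (fun _ => (0 : ℝ)) (cube := fun τ => Sum.elim (fun _ => (0 : Fin 2)) (fun Y => Y.1) τ)
    (fun _ _ h => Matrix.one_apply_ne h) Matrix.PosDef.one (fun _ => rfl) univ ∅ (fun _ : Unit => Sum.inr ⟨(0 : Fin 2), mem_univ _⟩)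
  exact h

end Literature.MathematicalPhysics.QuantumFieldTheory.BalabanImbrieJaffe1984to88.BIJ88Eq5145HeadMultiCubeInstance

end
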